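import Summits.CriticalPhenomena.PercolationContinuityZ3.Theorems.PercNearOneGluingNoHeavyLowerTailSunflowerBipartiteConditioning
import HarnessLib

/-!
# `NoHeavyLowerTail` (crux stmt-CriticalPhenomena-4575), abstract sunflower cubic: BIPARTITE GRAPH CORES ARE A-SAFE — part 4: the fibrewise sum and the THEOREM `safe_edgeCore_of_bipartite`

Support file (seat `prim-ineq-prove-1` gen 40; `--supports stmt-CriticalPhenomena-4575`).  No `sorry`, no named facts.  Memo:
run/shared/lean/prim/prim-ineq-prove-1/FINDING-BIPARTITE-prove1-g40.md (§1 polarisation, §2 symmetrisation, §3 conditioning, §4 the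
type-model lemma = `TypeModel.Model.typeModel_lemma` of `…SunflowerTypeModelLemma`).

THE THEOREM (file `…SunflowerBipartiteSafe`, `Bridge.safe_edgeCore_of_bipartite`): **every bipartite graph core is safe for every
parameter vector** — if `L` is one side of a bipartition of `Γ : SimpleGraph (Fin n)` then `SafeCalc.Safe p (SafeCalc.edgeCore Γ)` for all
`p`, i.e. Lemma A `∏_k μ_p(V k) ≤ μ_p(A)^(K−1)` for every number `K` of petals (g39's conjecture `TriangleFreeSafe` on the bipartite
stratum: all trees, even cycles, grids, cubes, `K_{a,b}` minus anything, …).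

THIS FILE (§3 end + assembly).  `resL`/`glue` bookkeeping, `fibre_eq_image` (a fibre of the L-restriction inside `confs m` is the
injective `glue`-image of the R-configurations), **`weighted_of_bipartite`** (the global weighted inequality for every profile = the sum of
`typeModel_lemma` over the L-parts), `petalData_Wof`, and the headline **`safe_edgeCore_of_bipartite`** (polarisation of both sides,
`sum_wprof_le_of_fibrewise`, `polarised_of_weighted`, `weighted_of_bipartite`).
-/

namespace Summit.CriticalPhenomena.PercolationContinuityZ3.Theorems.SunflowerPartition

namespace Bridge

open Finset MeasureTheory Literature.Probability.LatticeModels Literature.Probability.Percolation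

variable {K n : ℕ}

section Main

variable (Γ : SimpleGraph (Fin n)) (L : Finset (Fin n)) (V : Fin K → Set (Set (Fin n)))

/-! #### The fibrewise sum: the global weighted inequality for bipartite graphs -/

/-- Restriction of an assignment to the L-side (zero outside). -/
def resL (S : Fin n → Finset (Fin K)) : Fin n → Finset (Fin K) := fun x => if x ∈ L then S x else ∅

/-- Gluing the L-restriction and the R-restriction of an assignment gives it back. [this work] -/
theorem glue_restrict (S : Fin n → Finset (Fin K)) : glue L (resL L S) (fun x : Rv L => S x.1) = S := by
  funext x
  unfold glue resL
  by_cases hx : x ∈ L <;> simp [hx]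

/-- Gluing with a fixed L-part is injective in the R-part. [this work] -/
theorem glue_injective (SL : Fin n → Finset (Fin K)) : Function.Injective (glue L SL) := by
  intro T T' h
  funext x
  have := congrFun h x.1
  unfold glue at this
  simp only [x.2, dif_neg, not_false_eq_true] at this
  exact this

/-- The L-restriction of a glued assignment. [this work] -/
theorem resL_glue (SL : Fin n → Finset (Fin K)) (T : Rv L → Finset (Fin K)) : resL L (glue L SL T) = resL L SL := by
  funext x; unfold resL glue; by_cases hx : x ∈ L <;> simp [hx]

/-- `resL` is idempotent. [this work] -/
theorem resL_resL (S : Fin n → Finset (Fin K)) : resL L (resL L S) = resL L S := by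
  funext x; unfold resL; by_cases hx : x ∈ L <;> simp [hx]

/-- The fibre of `resL` over `resL S₀` inside `confs m` is the injective image under `glue` of the R-configurations of profile
`m ∘ val`. -/
theorem fibre_eq_image (m : Fin n → ℕ) {S₀ : Fin n → Finset (Fin K)} (hS₀ : S₀ ∈ TypeModel.Model.confs m) :
    ((TypeModel.Model.confs m).filter fun S => resL L S = resL L S₀) =
      (TypeModel.Model.confs (fun x : Rv L => m x.1)).image (glue L (resL L S₀)) := by
  classical
  ext S
  rw [Finset.mem_filter, Finset.mem_image, TypeModel.Model.mem_confs]
  rw [TypeModel.Model.mem_confs] at hS₀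
  constructor
  · rintro ⟨hS, hres⟩
    refine ⟨fun x => S x.1, ?_, ?_⟩
    · rw [TypeModel.Model.mem_confs]; intro x; exact hS x.1
    · rw [← hres]; exact glue_restrict L S
  · rintro ⟨T, hT, rfl⟩
    rw [TypeModel.Model.mem_confs] at hT
    refine ⟨fun x => ?_, ?_⟩
    · unfold glue
      by_cases hx : x ∈ L
      · simp only [hx, dif_pos]; unfold resL; rw [if_pos hx]; exact hS₀ x
      · simp only [hx, dif_neg, not_false_eq_true]; exact hT ⟨x, hx⟩
    · rw [resL_glue, resL_resL]

open scoped Classical in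
/-- **G3 (CONDITIONING).**  For a bipartite graph with side `L` and up-sets `V k` meeting pairwise inside the core, the global
weighted inequality `Σ_{BAD} (K − |J|)! ≤ (K−1)!·#GOOD` holds for every profile (sum of `typeModel_lemma` over the L-parts).
[this work] -/
theorem weighted_of_bipartite (H : Hyp Γ L V) (m : Fin n → ℕ) :
    ∑ S ∈ (TypeModel.Model.confs m).filter (fun S => BadG (SafeCalc.edgeCore Γ) (Wof Γ V) S),
        (K - (J (SafeCalc.edgeCore Γ) S).card).factorial ≤
      (K - 1).factorial * ((TypeModel.Model.confs m).filter fun S => GoodG (SafeCalc.edgeCore Γ) (Wof Γ V) S).card := by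
  classical
  set C := TypeModel.Model.confs (ι := Fin n) (K := K) m with hC
  set keys := C.image (resL L) with hkeys
  have hmaps : ∀ S ∈ C, resL L S ∈ keys := fun S hS => Finset.mem_image_of_mem _ hS
  -- regroup both sides over the keys
  have lhs : ∑ S ∈ C.filter (fun S => BadG (SafeCalc.edgeCore Γ) (Wof Γ V) S),
        (K - (J (SafeCalc.edgeCore Γ) S).card).factorial =
      ∑ SL ∈ keys, ∑ S ∈ (C.filter fun S => resL L S = SL),
        (if BadG (SafeCalc.edgeCore Γ) (Wof Γ V) S then (K - (J (SafeCalc.edgeCore Γ) S).card).factorial else 0) := by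
    rw [Finset.sum_filter, ← Finset.sum_fiberwise_of_maps_to hmaps]
  have rhs : ((C.filter fun S => GoodG (SafeCalc.edgeCore Γ) (Wof Γ V) S).card : ℕ) =
      ∑ SL ∈ keys, ((C.filter fun S => resL L S = SL).filter fun S => GoodG (SafeCalc.edgeCore Γ) (Wof Γ V) S).card := by
    rw [Finset.card_filter, ← Finset.sum_fiberwise_of_maps_to hmaps]
    refine Finset.sum_congr rfl fun SL _ => ?_
    rw [Finset.card_filter]
  rw [lhs, rhs, Finset.mul_sum]
  refine Finset.sum_le_sum fun SL hSL => ?_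
  -- the key SL = resL S₀ for some S₀ ∈ C
  obtain ⟨S₀, hS₀, rfl⟩ := Finset.mem_image.1 hSL
  rw [fibre_eq_image L m hS₀]
  set SL := resL L S₀
  set M := modelOf Γ L V SL H with hM
  set CR := TypeModel.Model.confs (K := K) (fun x : Rv L => m x.1) with hCR
  have hinj := glue_injective L SL
  -- left: sum over the image = sum over R-configurations
  rw [Finset.sum_image (fun T _ T' _ h => hinj h)]
  -- right: card of the filtered image = card of filtered R-configurations
  rw [Finset.filter_image, Finset.card_image_of_injective _ hinj]
  -- compare with the type-model lemma for M
  have step1 : ∑ T ∈ CR, (if BadG (SafeCalc.edgeCore Γ) (Wof Γ V) (glue L SL T) then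
        (K - (J (SafeCalc.edgeCore Γ) (glue L SL T)).card).factorial else 0) ≤
      ∑ T ∈ CR.filter (fun T => M.Bad T), (K - (M.nonA T).card).factorial := by
    rw [Finset.sum_filter]
    refine Finset.sum_le_sum fun T _ => ?_
    by_cases hb : BadG (SafeCalc.edgeCore Γ) (Wof Γ V) (glue L SL T)
    · have hB : M.Bad T := bad_of_badG Γ L V SL H hb
      rw [if_pos hb, if_pos hB, nonA_modelOf_eq_J Γ L V SL H T]
    · rw [if_neg hb]; exact Nat.zero_le _
  have step2 := M.typeModel_lemma (fun x : Rv L => m x.1)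
  have step3 : (CR.filter fun T => M.Good T).card ≤
      (CR.filter fun T => GoodG (SafeCalc.edgeCore Γ) (Wof Γ V) (glue L SL T)).card :=
    Finset.card_le_card (Finset.monotone_filter_right _ fun T _ hg => goodG_of_good Γ L V SL H hg)
  calc ∑ T ∈ CR, (if BadG (SafeCalc.edgeCore Γ) (Wof Γ V) (glue L SL T) then
          (K - (J (SafeCalc.edgeCore Γ) (glue L SL T)).card).factorial else 0)
      ≤ ∑ T ∈ CR.filter (fun T => M.Bad T), (K - (M.nonA T).card).factorial := step1
    _ ≤ (K - 1).factorial * (CR.filter fun T => M.Good T).card := step2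
    _ ≤ (K - 1).factorial * (CR.filter fun T => GoodG (SafeCalc.edgeCore Γ) (Wof Γ V) (glue L SL T)).card :=
        Nat.mul_le_mul_left _ step3

end Main

/-! ### G4: assembly -/

/-- The petal parts `Wof` of a family meeting pairwise inside the core form petal data. -/
theorem petalData_Wof (Γ : SimpleGraph (Fin n)) (V : Fin K → Set (Set (Fin n)))
    (hVcap : ∀ i j, i ≠ j → V i ∩ V j ⊆ SafeCalc.edgeCore Γ) : PetalData (SafeCalc.edgeCore Γ) (Wof Γ V) where
  disjA := fun _ _ h => h.2
  disj := fun k l ω hk hl => by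
    by_contra hkl
    exact hk.2 (hVcap k l hkl ⟨hk.1, hl.1⟩)

open scoped Classical in
/-- **THEOREM (g40).  Every bipartite graph core is safe, for every parameter vector** — Lemma A for every number of petals:
if `L` is one side of a bipartition of `Γ` then `SafeCalc.Safe p (SafeCalc.edgeCore Γ)` for all `p`. [this work] -/
theorem safe_edgeCore_of_bipartite (Γ : SimpleGraph (Fin n)) (L : Finset (Fin n))
    (hL : ∀ u v, Γ.Adj u v → (u ∈ L ↔ v ∉ L)) (p : Fin n → unitInterval) : SafeCalc.Safe p (SafeCalc.edgeCore Γ) := by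
  classical
  intro K V hV hcap
  set A := SafeCalc.edgeCore Γ with hA
  rcases Nat.eq_zero_or_pos K with hK | hK
  · subst hK; simp
  -- the free slot
  set last : Fin K := ⟨K - 1, by omega⟩ with hlast
  have H : Hyp Γ L V := ⟨hL, hV, hcap⟩
  have hPD : PetalData A (Wof Γ V) := petalData_Wof Γ V hcap
  -- polarisation of the left-hand side
  rw [prod_real_eq_sum_wprof p V]
  -- the right-hand side as a product over the family `V''`
  set V'' : Fin K → Set (Set (Fin n)) := fun k => if k = last then Set.univ else A with hV''
  have hrhs : ((prodBernoulli p).real A) ^ (K - 1) = ∏ k, (prodBernoulli p).real (V'' k) := by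
    have e : (fun k => (prodBernoulli p).real (V'' k)) =
        fun k => if k = last then (prodBernoulli p).real (Set.univ : Set (Set (Fin n))) else (prodBernoulli p).real A := by
      funext k; by_cases hk : k = last <;> simp [hV'', hk]
    rw [e, Finset.prod_ite, Finset.prod_const, Finset.prod_const, probReal_univ, one_pow, one_mul]
    congr 1
    have : (Finset.univ.filter fun k : Fin K => ¬ k = last) = Finset.univ.erase last := by
      ext k; simp
    rw [this, Finset.card_erase_of_mem (Finset.mem_univ _), Finset.card_univ, Fintype.card_fin]
  rw [hrhs, prod_real_eq_sum_wprof p V'']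
  have hQ : ∀ S : Fin n → Finset (Fin K), (∀ k, row S k ∈ V'' k) ↔ (∀ k, k ≠ last → row S k ∈ A) := by
    intro S
    refine forall_congr' fun k => ?_
    by_cases hk : k = last <;> simp [hV'', hk]
  simp_rw [hQ]
  -- fibrewise comparison
  refine sum_wprof_le_of_fibrewise p _ _ fun m => ?_
  calc ((TypeModel.Model.confs m).filter fun S => ∀ k, row S k ∈ V k).card
      ≤ ((TypeModel.Model.confs m).filter fun S => ∀ k, row S k ∈ A ∪ Wof Γ V k).card := by
        refine Finset.card_le_card (Finset.monotone_filter_right _ fun S _ h k => ?_)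
        by_cases hkA : row S k ∈ A
        · exact Or.inl hkA
        · exact Or.inr ⟨h k, hkA⟩
    _ ≤ ((TypeModel.Model.confs m).filter fun S => ∀ k, k ≠ last → row S k ∈ A).card := by
        have hw := weighted_of_bipartite Γ L V H m
        convert polarised_of_weighted hPD m last (by convert hw using 2) using 2


end Bridge

end Summit.CriticalPhenomena.PercolationContinuityZ3.Theorems.SunflowerPartition
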